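import Literature.MathematicalPhysics.QuantumLattice.LatticeGaugeDLRGibbsProofs
import HarnessLib

/-!
# Finite-volume DLR identity for Wilson-type weights on an abstract finite volume

Helper file for stub `stub_tubeLimitState` of crux `FibreToTorus` (stmt-QuantumFields-16244),
line `uniqueness`, route `ContractibleFibre`.  The torus bridge
`wilsonExpectation_toTorusObservable_eq` of `LatticeGaugeDLRGibbsProofs.lean` is generalised
from the periodic torus to an ARBITRARY finite edge set `E` charted into `ℤᵈ` by a map
`π : ZdEdge d → E` (configurations `V : E → G` are read on `ℤᵈ` as `V ∘ π`): if `π` is injective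
on `Λ ∪ S₀ ∪ ∂Λ` and the log-weight splits as `a + b` with `a = -β S_Λ(V ∘ π) + c` (the Wilson
boundary action of `Λ` read through the chart, up to a constant) and `b` blind to the edges
`π(Λ)`, then under the weight `e^{a+b} dHaar^E` the observable `F(V ∘ π)` (bounded measurable,
cylinder on `S₀`) may be replaced by its Wilson-kernel average `(γ_Λ F)(V ∘ π)`.  This is the
local DLR equation of the free tubes (and of any free / mixed boundary condition).
-/

noncomputable section

open MeasureTheory Filter Topology Finset
open Literature.Probability.LatticeModels
open Literature.MathematicalPhysics.QuantumLattice
open Literature.MathematicalPhysics.QuantumFieldTheory (haarProbability)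

namespace Summit.QuantumFields.YangMills.Theorems.FibreToTorus

variable {d N : ℕ} {G : Type*} [Group G] [TopologicalSpace G] [IsTopologicalGroup G]
  [CompactSpace G] [MeasurableSpace G] [BorelSpace G] (ρ : G →* Matrix (Fin N) (Fin N) ℂ)
  {E : Type*} [Fintype E] [DecidableEq E] (π : ZdEdge d → E)

omit [Group G] [TopologicalSpace G] [IsTopologicalGroup G] [CompactSpace G] [MeasurableSpace G]
  [BorelSpace G] [Fintype E] in
/-- **Chart reading of a resampled configuration.** On an edge set `T ⊇ Λ` on which the chart
`π` is injective, reading through `π` the configuration whose edges in `Λ.image π` are taken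
from `W` (and the others from `V`) agrees on `T` with gluing `W ∘ π|_Λ` into `V ∘ π`. [folklore] -/
theorem piecewise_comp_chart_apply {Λ T : Finset (ZdEdge d)} (hΛT : Λ ⊆ T)
    (hinj : Set.InjOn π ↑T) (W V : E → G) {e : ZdEdge d} (he : e ∈ T) :
    (Λ.image π).piecewise W V (π e) = glueWith Λ (fun e' : ↥Λ => W (π e')) (V ∘ π) e := by
  classical
  by_cases heΛ : e ∈ Λ
  · rw [piecewise_eq_of_mem _ _ _ (mem_image_of_mem _ heΛ), glueWith_apply_mem _ _ _ heΛ]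
  · rw [glueWith_apply_not_mem _ _ _ heΛ, piecewise_eq_of_notMem]
    · rfl
    · intro hmem
      obtain ⟨e'', he'', h⟩ := mem_image.1 hmem
      exact heΛ (hinj (hΛT he'') he h ▸ he'')

omit [Group G] [TopologicalSpace G] [IsTopologicalGroup G] [CompactSpace G] [BorelSpace G]
  [Fintype E] [DecidableEq E] in
/-- Reading a configuration of the finite volume through the chart is measurable. [folklore] -/
theorem measurable_comp_chart : Measurable fun V : E → G => (V ∘ π : LGConfig d G) :=
  measurable_pi_lambda _ fun e => measurable_pi_apply (π e)

omit [Group G] [IsTopologicalGroup G] [CompactSpace G] [MeasurableSpace G] [BorelSpace G]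
  [Fintype E] [DecidableEq E] in
/-- Reading a configuration of the finite volume through the chart is continuous. [folklore] -/
theorem continuous_comp_chart : Continuous fun V : E → G => (V ∘ π : LGConfig d G) :=
  continuous_pi fun e => continuous_apply (π e)

variable [SecondCountableTopology G]

/-- **Local DLR identity for a charted finite volume.** Let `π : ZdEdge d → E` be injective on
`T = Λ ∪ S₀ ∪ ∂Λ` (`∂Λ` = the edges of the plaquettes touching `Λ`), let the log-weight be
`a + b` with `a V = -β S_Λ(V ∘ π) + c` and `b` invariant under resampling the edges in
`Λ.image π`, and let `F` be a bounded measurable cylinder observable on `ℤᵈ` with support `S₀`.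
Then `∫ e^{a+b} F(V∘π) dV = ∫ e^{a+b} (γ_Λ F)(V∘π) dV` over the product Haar measure on `E → G`:
the conditional law of the edges `π(Λ)` given the rest is the Wilson kernel `γ_Λ(· | V∘π)`
(resampling identity `integral_exp_mul_eq_integral_exp_mul_condAvg`; Georgii 2011 Prop. 2.5 /
(4.18); Friedli–Velenik 2017 Lemma 6.7 and Exercise 6.14 for free boundary conditions). [folklore] -/
theorem integral_weight_comp_chart_eq_condAvg (hρ : Continuous ρ) (β : ℝ)
    (Λ S₀ : Finset (ZdEdge d))
    (hinj : Set.InjOn π ↑(Λ ∪ S₀ ∪ (plaquettesTouching Λ).biUnion plaquetteEdges))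
    {a b : (E → G) → ℝ} (hac : Continuous a) (hbc : Continuous b) {c : ℝ}
    (ha : ∀ V, a V = -β * wilsonBoundaryAction ρ Λ (V ∘ π) + c)
    (hb : ∀ W V, b ((Λ.image π).piecewise W V) = b V)
    {F : LGConfig d G → ℝ} (hFm : Measurable F) {C : ℝ} (hC : ∀ U, |F U| ≤ C)
    (hFS : IsCylinder F S₀) :
    ∫ V, Real.exp (a V + b V) * F (V ∘ π) ∂(Measure.pi fun _ : E => haarProbability G) =
      ∫ V, Real.exp (a V + b V) * (∫ U, F U ∂(ymSpecification ρ β Λ (V ∘ π)))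
        ∂(Measure.pi fun _ : E => haarProbability G) := by
  classical
  -- the relevant finite edge set `T` and the injectivity consequences of `hinj`
  have hΛT : Λ ⊆ Λ ∪ S₀ ∪ (plaquettesTouching Λ).biUnion plaquetteEdges :=
    subset_union_left.trans subset_union_left
  have hS₀T : S₀ ⊆ Λ ∪ S₀ ∪ (plaquettesTouching Λ).biUnion plaquetteEdges :=
    subset_union_right.trans subset_union_left
  have hPT : (plaquettesTouching Λ).biUnion plaquetteEdges ⊆
      Λ ∪ S₀ ∪ (plaquettesTouching Λ).biUnion plaquetteEdges := subset_union_right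
  obtain ⟨A, hA⟩ := exists_bound_of_continuous hac
  obtain ⟨B, hB⟩ := exists_bound_of_continuous hbc
  have hτ : Function.Injective fun e : ↥Λ => π (e : ZdEdge d) := fun e₁ e₂ h =>
    Subtype.ext (hinj (hΛT e₁.2) (hΛT e₂.2) h)
  -- transfer of the fibre integrals from `G^Λ` to the finite volume `G^E`
  have transfer : ∀ Φ : LGConfig d G → ℝ, Measurable Φ →
      DependsOn Φ ↑(Λ ∪ S₀ ∪ (plaquettesTouching Λ).biUnion plaquetteEdges) →
      ∀ V : E → G,
        ∫ ζ, Φ (glueWith Λ ζ (V ∘ π)) ∂(Measure.pi fun _ : ↥Λ => haarProbability G) =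
          ∫ W, Φ ((Λ.image π).piecewise W V ∘ π) ∂(Measure.pi fun _ : E => haarProbability G) := by
    intro Φ hΦm hΦT V
    have hm : Measurable fun (W : E → G) (e : ↥Λ) => W (π (e : ZdEdge d)) :=
      measurable_pi_iff.2 fun e => measurable_pi_apply _
    have hc : Measurable fun ζ : ↥Λ → G => Φ (glueWith Λ ζ (V ∘ π)) :=
      hΦm.comp (measurable_glueWith Λ _)
    rw [← pi_map_comp_injective (haarProbability G) hτ,
      integral_map hm.aemeasurable hc.aestronglyMeasurable]
    refine congrArg _ (funext fun W => hΦT fun e he => ?_)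
    exact (piecewise_comp_chart_apply π hΛT hinj W V he).symm
  -- locality of the two fibre integrands
  have hST : DependsOn (wilsonBoundaryAction (G := G) ρ Λ)
      ↑(Λ ∪ S₀ ∪ (plaquettesTouching Λ).biUnion plaquetteEdges) :=
    (isCylinder_wilsonBoundaryAction_holds (G := G) ρ Λ).mono (Finset.coe_subset.2 hPT)
  have hFT : DependsOn F ↑(Λ ∪ S₀ ∪ (plaquettesTouching Λ).biUnion plaquetteEdges) :=
    hFS.mono (Finset.coe_subset.2 hS₀T)
  have hw : Continuous fun U : LGConfig d G => Real.exp (-β * wilsonBoundaryAction ρ Λ U) :=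
    Real.continuous_exp.comp (continuous_const.mul (continuous_wilsonBoundaryAction ρ hρ Λ))
  -- the kernel average of `F` at the boundary condition `V ∘ π`, computed on `G^E`
  have key : ∀ V : E → G,
      ∫ U, F U ∂(ymSpecification ρ β Λ (V ∘ π)) =
        (∫ W, F ((Λ.image π).piecewise W V ∘ π) * Real.exp (a ((Λ.image π).piecewise W V))
            ∂(Measure.pi fun _ : E => haarProbability G)) /
          ∫ W, Real.exp (a ((Λ.image π).piecewise W V))
            ∂(Measure.pi fun _ : E => haarProbability G) := by
    intro V
    rw [integral_ymSpecification ρ hρ β Λ hFm,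
      transfer (fun U => F U * Real.exp (-β * wilsonBoundaryAction ρ Λ U)) (hFm.mul hw.measurable)
        (fun x y h => by simp only [hFT h, hST h]),
      transfer (fun U => Real.exp (-β * wilsonBoundaryAction ρ Λ U)) hw.measurable
        (fun x y h => by simp only [hST h])]
    have e1 : (fun W : E → G => F ((Λ.image π).piecewise W V ∘ π) *
        Real.exp (a ((Λ.image π).piecewise W V))) = fun W =>
        (F ((Λ.image π).piecewise W V ∘ π) *
          Real.exp (-β * wilsonBoundaryAction ρ Λ ((Λ.image π).piecewise W V ∘ π))) *
            Real.exp c := by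
      funext W; rw [ha, Real.exp_add]; ring
    have e2 : (fun W : E → G => Real.exp (a ((Λ.image π).piecewise W V))) = fun W =>
        Real.exp (-β * wilsonBoundaryAction ρ Λ ((Λ.image π).piecewise W V ∘ π)) *
          Real.exp c := by
      funext W; rw [ha, Real.exp_add]
    rw [e1, e2, integral_mul_const, integral_mul_const,
      mul_div_mul_right _ _ (Real.exp_pos c).ne']
  -- conclude with the finite-volume DLR identity on `G^E`
  have hmain := integral_exp_mul_eq_integral_exp_mul_condAvg (haarProbability G) (Λ.image π)
    (F := fun V : E → G => F (V ∘ π))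
    (NF := fun V => ∫ W, F ((Λ.image π).piecewise W V ∘ π) *
      Real.exp (a ((Λ.image π).piecewise W V)) ∂(Measure.pi fun _ : E => haarProbability G))
    (N1 := fun V => ∫ W, Real.exp (a ((Λ.image π).piecewise W V))
      ∂(Measure.pi fun _ : E => haarProbability G))
    (hFm.comp (measurable_comp_chart π)) hac.measurable hbc.measurable (fun V => hC _) hA hB hb
    (fun V => rfl) (fun V => rfl)
  rw [hmain]
  refine congrArg _ (funext fun V => ?_)
  rw [key V]

omit [SecondCountableTopology G] in
/-- **Registered form (sub-goal `tubeLimit_localDLR` of `stub_tubeLimitState`)** of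
`integral_weight_comp_chart_eq_condAvg`: closed statement. [folklore] -/
theorem tubeLimit_localDLR : ∀ (d N : ℕ) (G : Type) [Group G] [TopologicalSpace G] [IsTopologicalGroup G] [CompactSpace G] [MeasurableSpace G] [BorelSpace G] [SecondCountableTopology G] (ρ : G →* Matrix (Fin N) (Fin N) ℂ), Continuous ρ → ∀ (β : ℝ) (E : Type) [Fintype E] [DecidableEq E] (π : ZdEdge d → E) (Λ S₀ : Finset (ZdEdge d)), Set.InjOn π ↑(Λ ∪ S₀ ∪ (plaquettesTouching Λ).biUnion plaquetteEdges) → ∀ (a b : (E → G) → ℝ) (c : ℝ), Continuous a → Continuous b → (∀ V, a V = -β * wilsonBoundaryAction ρ Λ (V ∘ π) + c) → (∀ W V, b ((Λ.image π).piecewise W V) = b V) → ∀ (F : LGConfig d G → ℝ) (C : ℝ), Measurable F → (∀ U, |F U| ≤ C) → IsCylinder F S₀ → ∫ V, Real.exp (a V + b V) * F (V ∘ π) ∂(MeasureTheory.Measure.pi fun _ : E => haarProbability G) = ∫ V, Real.exp (a V + b V) * (∫ U, F U ∂(ymSpecification ρ β Λ (V ∘ π))) ∂(MeasureTheory.Measure.pi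 fun _ : E => haarProbability G) :=
  fun d _ _ _ _ _ _ _ _ _ ρ hρ β _ _ _ π Λ S₀ hinj _ _ _ hac hbc ha hb _ _ hFm hC hFS =>
    integral_weight_comp_chart_eq_condAvg (d := d) ρ π hρ β Λ S₀ hinj hac hbc ha hb hFm hC hFS

end Summit.QuantumFields.YangMills.Theorems.FibreToTorus

end
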